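import Mathlib
import Summits.MatrixMultiplication.Statement
import Summits.MatrixMultiplication.MatrixMultiplication.Theorems.GraphEquationsTowerStages

/-!
# Graph equations — transporting a tower along a reindexing of the kernel coordinates (M24c)

`exists_towerStages` produces its kernel coordinates indexed by an abstract finite type `κ`
(an iterated sum type); the S1 binder of `familyRung_of_towerSupply` wants `Fin a`.  This file
transports a tower along an equivalence `e : κ ≃ κ'` (variables `Sum.map id e`, derivations by
conjugation `conjDer`, words and extras by `map`, the point by `lam ∘ e.symm`) and records
`exists_towerStages_fin`: the identity tower with kernel coordinates `Fin a`.
-/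

set_option linter.dupNamespace false

noncomputable section

open scoped BigOperators

namespace Summit.MatrixMultiplication.MatrixMultiplication.Theorems.GraphEquations

open MvPolynomial
open Literature.Computability.AlgebraicComplexity

variable {n : ℕ}

section Conj

variable {κ κ' : Type}

/-- The reindexing `Sum.map id e` is undone by `Sum.map id e.symm`. -/
theorem sumMap_symm_apply (e : κ ≃ κ') (v : GraphVars n ⊕ κ) :
    Sum.map id e.symm (Sum.map id e v) = v := by
  cases v <;> simp

/-- The reindexing `Sum.map id e.symm` is undone by `Sum.map id e`. -/
theorem sumMap_apply_symm (e : κ ≃ κ') (v : GraphVars n ⊕ κ') :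
    Sum.map id e (Sum.map id e.symm v) = v := by
  cases v <;> simp

/-- `Sum.map id e` is injective. -/
theorem sumMap_injective (e : κ ≃ κ') :
    Function.Injective (Sum.map (id : GraphVars n → GraphVars n) e) :=
  Sum.map_injective.mpr ⟨fun _ _ h => h, e.injective⟩

/-- A derivation transported along the reindexing `Sum.map id e` (conjugation). -/
def conjDer (e : κ ≃ κ')
    (D : Derivation ℂ (MvPolynomial (GraphVars n ⊕ κ) ℂ) (MvPolynomial (GraphVars n ⊕ κ) ℂ)) :
    Derivation ℂ (MvPolynomial (GraphVars n ⊕ κ') ℂ) (MvPolynomial (GraphVars n ⊕ κ') ℂ) :=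
  mkDerivation ℂ fun j => rename (Sum.map id e) (D (X (Sum.map id e.symm j)))

/-- `conjDer` on variables. -/
theorem conjDer_X (e : κ ≃ κ')
    (D : Derivation ℂ (MvPolynomial (GraphVars n ⊕ κ) ℂ) (MvPolynomial (GraphVars n ⊕ κ) ℂ))
    (j : GraphVars n ⊕ κ') :
    conjDer e D (X j) = rename (Sum.map id e) (D (X (Sum.map id e.symm j))) := by
  rw [conjDer, mkDerivation_X]

/-- **Conjugation identity**: `conjDer e D (ρ p) = ρ (D p)` for `ρ = rename (Sum.map id e)`. -/
theorem conjDer_rename (e : κ ≃ κ')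
    (D : Derivation ℂ (MvPolynomial (GraphVars n ⊕ κ) ℂ) (MvPolynomial (GraphVars n ⊕ κ) ℂ))
    (p : MvPolynomial (GraphVars n ⊕ κ) ℂ) :
    conjDer e D (rename (Sum.map id e) p) = rename (Sum.map id e) (D p) := by
  unfold conjDer
  exact mkDerivation_rename_eq _ D _ (fun i => by rw [sumMap_symm_apply]) p

/-- Conjugation preserves cost-freeness. -/
theorem conjDer_X_mem_freeSpan (e : κ ≃ κ')
    {D : Derivation ℂ (MvPolynomial (GraphVars n ⊕ κ) ℂ) (MvPolynomial (GraphVars n ⊕ κ) ℂ)}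
    (hD : ∀ v, D (X v) ∈ freeSpan ∅) (j : GraphVars n ⊕ κ') : conjDer e D (X j) ∈ freeSpan ∅ := by
  rw [conjDer_X]
  exact rename_mem_freeSpan_empty _ (hD _)

/-- Conjugation preserves killing the base coordinates `a, b`. -/
theorem conjDer_X_base (e : κ ≃ κ')
    {D : Derivation ℂ (MvPolynomial (GraphVars n ⊕ κ) ℂ) (MvPolynomial (GraphVars n ⊕ κ) ℂ)}
    (hD : ∀ v : MatMulVars n, D (X (Sum.inl (Sum.inl v))) = 0) (v : MatMulVars n) :
    conjDer e D (X (Sum.inl (Sum.inl v))) = 0 := by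
  rw [conjDer_X]
  simp only [Sum.map_inl, id_eq]
  rw [hD, map_zero]

/-- Conjugated words act on transported polynomials as the transport of the original action. -/
theorem foldl_map_conjDer_rename (e : κ ≃ κ')
    (w : List (Derivation ℂ (MvPolynomial (GraphVars n ⊕ κ) ℂ) (MvPolynomial (GraphVars n ⊕ κ) ℂ)))
    (g : MvPolynomial (GraphVars n ⊕ κ) ℂ) :
    (w.map (conjDer e)).foldl (fun acc D => D acc) (rename (Sum.map id e) g) =
      rename (Sum.map id e) (w.foldl (fun acc D => D acc) g) := by
  induction w generalizing g with
  | nil => rfl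
  | cons D w ih => rw [List.map_cons, List.foldl_cons, List.foldl_cons, conjDer_rename, ih]

/-- The embedded base polynomials are fixed by the transport. -/
theorem rename_sumMap_rename_inl (e : κ ≃ κ') (t : MvPolynomial (GraphVars n) ℂ) :
    rename (Sum.map id e) (rename Sum.inl t : MvPolynomial (GraphVars n ⊕ κ) ℂ) =
      (rename Sum.inl t : MvPolynomial (GraphVars n ⊕ κ') ℂ) := by
  rw [rename_rename]; rfl

/-- Sublists are preserved by `map`. -/
theorem sublist_map_conjDer (e : κ ≃ κ')
    {w Ds : List (Derivation ℂ (MvPolynomial (GraphVars n ⊕ κ) ℂ) (MvPolynomial (GraphVars n ⊕ κ) ℂ))}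
    (h : w.Sublist Ds) : (w.map (conjDer e)).Sublist (Ds.map (conjDer e)) :=
  h.map _

variable {K : Type*} [Field K] [Algebra ℂ K] [Algebra (MvPolynomial (MatMulVars n) ℂ) K]

/-- The transported point evaluates transported polynomials like the original point. -/
theorem aeval_towerPt_symm_rename (e : κ ≃ κ') (lam : κ → K) (g : MvPolynomial (GraphVars n ⊕ κ) ℂ) :
    aeval (towerPt (lam ∘ e.symm)) (rename (Sum.map id e) g) = aeval (towerPt lam) g := by
  rw [aeval_rename]
  have h : (towerPt (lam ∘ ⇑e.symm) ∘ Sum.map id ⇑e : GraphVars n ⊕ κ → K) = towerPt lam := by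
    funext v
    rcases v with v | x
    · rfl
    · simp [towerPt]
  rw [h]

/-- The fibre gradient of a transported polynomial at the transported point is the reindexed
fibre gradient. -/
theorem towerRow_symm_rename (e : κ ≃ κ') (lam : κ → K) (g : MvPolynomial (GraphVars n ⊕ κ) ℂ) :
    towerRow (lam ∘ e.symm) (rename (Sum.map id e) g) =
      fun y => towerRow lam g (Sum.map id e.symm y) := by
  funext y
  unfold towerRow
  have hy : (Sum.elim (fun q => Sum.inl (Sum.inr q)) Sum.inr y : GraphVars n ⊕ κ') =
      Sum.map id e (Sum.elim (fun q => Sum.inl (Sum.inr q)) Sum.inr (Sum.map id e.symm y)) := by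
    rcases y with q | i <;> simp
  rw [hy, pderiv_rename (sumMap_injective e), aeval_towerPt_symm_rename]

/-- The reindexing of fibre gradients as a linear equivalence. -/
def rowCongr (n : ℕ) (K : Type*) [Field K] (e : κ ≃ κ') :
    ((Fin n × Fin n) ⊕ κ → K) ≃ₗ[K] ((Fin n × Fin n) ⊕ κ' → K) :=
  LinearEquiv.funCongrLeft K K (Equiv.sumCongr (Equiv.refl _) e.symm)

omit [Algebra ℂ K] [Algebra (MvPolynomial (MatMulVars n) ℂ) K] in
/-- `rowCongr` is precomposition with `Sum.map id e.symm`. -/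
theorem rowCongr_apply (e : κ ≃ κ') (f : (Fin n × Fin n) ⊕ κ → K) (y : (Fin n × Fin n) ⊕ κ') :
    rowCongr n K e f y = f (Sum.map id e.symm y) := by
  rcases y with q | i <;> simp [rowCongr, LinearEquiv.funCongrLeft_apply]

/-- Spanning rows transport to spanning rows. -/
theorem span_towerRow_transport_eq_top (e : κ ≃ κ') (lam : κ → K)
    {G : Set (MvPolynomial (GraphVars n ⊕ κ) ℂ)} {G' : Set (MvPolynomial (GraphVars n ⊕ κ') ℂ)}
    (hGG' : ∀ g ∈ G, rename (Sum.map id e) g ∈ G')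
    (hspan : Submodule.span K (towerRow lam '' G) = ⊤) :
    Submodule.span K (towerRow (lam ∘ e.symm) '' G') = ⊤ := by
  rw [eq_top_iff]
  have htop : (⊤ : Submodule K ((Fin n × Fin n) ⊕ κ' → K)) =
      Submodule.map (rowCongr n K e : ((Fin n × Fin n) ⊕ κ → K) →ₗ[K] ((Fin n × Fin n) ⊕ κ' → K))
        (Submodule.span K (towerRow lam '' G)) := by
    rw [hspan, Submodule.map_top, LinearEquiv.range]
  rw [htop, Submodule.map_span]
  refine Submodule.span_mono ?_
  rintro f ⟨r, ⟨g, hg, rfl⟩, rfl⟩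
  refine ⟨rename (Sum.map id e) g, hGG' g hg, ?_⟩
  funext y
  rw [towerRow_symm_rename, LinearEquiv.coe_coe, rowCongr_apply]

end Conj

section Fin

variable {K : Type*} [Field K] [Algebra ℂ K] [Algebra (MvPolynomial (MatMulVars n) ℂ) K]
  [IsScalarTower ℂ (MvPolynomial (MatMulVars n) ℂ) K]

set_option maxHeartbeats 800000 in
/-- **The identity tower with kernel coordinates `Fin a`** (`exists_towerStages` transported along
`Fintype.equivFin`). -/
theorem exists_towerStages_fin {T : ℕ} (t : Fin T → MvPolynomial (GraphVars n) ℂ)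
    (ht : ∀ o, t o ∈ graphIdeal n) {m : ℕ} (hm : 1 ≤ m)
    (hgen : ∀ q, generator n q ^ m ∈ Ideal.span (Set.range t)) :
    ∃ (a : ℕ)
      (Ds : List (Derivation ℂ (MvPolynomial (GraphVars n ⊕ Fin a) ℂ)
        (MvPolynomial (GraphVars n ⊕ Fin a) ℂ)))
      (W : List (List (Derivation ℂ (MvPolynomial (GraphVars n ⊕ Fin a) ℂ)
        (MvPolynomial (GraphVars n ⊕ Fin a) ℂ))))
      (ex : List (MvPolynomial (GraphVars n ⊕ Fin a) ℂ)) (lam : Fin a → K),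
      Ds.length + 1 = m ∧ (∀ w ∈ W, w.Sublist Ds) ∧
      (∀ D ∈ Ds, (∀ v, D (X v) ∈ freeSpan ∅) ∧ ∀ v : MatMulVars n, D (X (Sum.inl (Sum.inl v))) = 0) ∧
      (∀ e ∈ ex, e ∈ freeSpan ∅) ∧
      (∀ o, ∀ w ∈ W, aeval (towerPt lam) (w.foldl (fun acc D => D acc) (rename Sum.inl (t o))) = 0) ∧
      (∀ e ∈ ex, aeval (towerPt lam) e = 0) ∧
      Submodule.span K (towerRow lam ''
        ({g | ∃ o, ∃ w ∈ W, g = w.foldl (fun acc D => D acc) (rename Sum.inl (t o))} ∪ {e | e ∈ ex})) =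
        ⊤ := by
  classical
  obtain ⟨κ, _, _, Ds, W, ex, lam, hlen, hsub, hDs, hex, hvanW, hvanE, hspan⟩ :=
    exists_towerStages (K := K) t ht hm hgen
  set e := Fintype.equivFin κ with he
  refine ⟨Fintype.card κ, Ds.map (conjDer e), W.map (List.map (conjDer e)), ex.map (rename (Sum.map id e)),
    lam ∘ e.symm, by rw [List.length_map, hlen], ?_, ?_, ?_, ?_, ?_, ?_⟩
  · intro w' hw'
    obtain ⟨w, hw, rfl⟩ := List.mem_map.mp hw'
    exact sublist_map_conjDer e (hsub w hw)
  · intro D' hD'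
    obtain ⟨D, hD, rfl⟩ := List.mem_map.mp hD'
    exact ⟨conjDer_X_mem_freeSpan e (hDs D hD).1, conjDer_X_base e (hDs D hD).2⟩
  · intro e' he'
    obtain ⟨e₁, he₁, rfl⟩ := List.mem_map.mp he'
    exact rename_mem_freeSpan_empty _ (hex e₁ he₁)
  · intro o w' hw'
    obtain ⟨w, hw, rfl⟩ := List.mem_map.mp hw'
    rw [← rename_sumMap_rename_inl e (t o), foldl_map_conjDer_rename, aeval_towerPt_symm_rename]
    exact hvanW o w hw
  · intro e' he'
    obtain ⟨e₁, he₁, rfl⟩ := List.mem_map.mp he'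
    rw [aeval_towerPt_symm_rename]
    exact hvanE e₁ he₁
  · refine span_towerRow_transport_eq_top e lam ?_ hspan
    rintro g (⟨o, w, hw, rfl⟩ | hg)
    · refine Or.inl ⟨o, w.map (conjDer e), List.mem_map.mpr ⟨w, hw, rfl⟩, ?_⟩
      rw [← foldl_map_conjDer_rename, rename_sumMap_rename_inl]
    · exact Or.inr (List.mem_map.mpr ⟨g, hg, rfl⟩)

end Fin

end Summit.MatrixMultiplication.MatrixMultiplication.Theorems.GraphEquations

end
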